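import Literature.NumberTheory.LFunctions.ExceptionalPrimesPowerSums
import Literature.NumberTheory.Sieve.CoprimeSquarefreeSums
import HarnessLib

/-!
# The hyperbola method for `∑_{n ≤ X} (1 ∗ χ)(n) n^{-β}` at a real zero `β` of `L(s, χ)`

Topic `Literature/NumberTheory/LFunctions`. Everything in this file is PROVED (theorems only);
third support file of the elementary proof of Heath-Brown's lemma on exceptional primes
(`ExceptionalPrimesSparse.lean`).

Let `χ ≠ χ₀` be a quadratic character mod `q`, `f = 1 ∗ χ` (Mathlib's `χ.zetaMul`, real and
`≥ 0`), `0 < β < 1` with `L(β, χ) = 0`, `X ≥ 1` an integer and `D = ⌊√X⌋`. Writing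
`G(X) = ∑_{n ≤ X} f(n) n^{-β} = ∑_{d ≤ X} χ(d) d^{-β} A(⌊X/d⌋)`, `A(K) = ∑_{e ≤ K} e^{-β}`
(`sum_re_zetaMul_mul_rpow_eq`, Dirichlet's hyperbola rearrangement), the range `d > D` is a
window sum of `χ` against the non-increasing weight `d^{-β} A(⌊X/d⌋)`, hence `≤ 2q (D+1)^{-β} A(D)`
in absolute value (`ExceptionalPrimesAbel.lean`), while for `d ≤ D` the comparison
`A(⌊X/d⌋) = A(D) + ((X/d)^{1-β} − D^{1-β})/(1-β) − ψ_d`, `0 ≤ ψ_d ≤ 2D^{-β}`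
(`ExceptionalPrimesPowerSums.lean`) produces the main term `(X^{1-β}/(1-β)) ∑_{d ≤ D} χ(d)/d`,
the term `(A(D) − D^{1-β}/(1-β)) ∑_{d ≤ D} χ(d) d^{-β}` — small because the partial sums of
`∑ χ(d) d^{-β}` at the ZERO `β` are `≤ 2q(D+1)^{-β}` — and an error `≤ 2D^{-β} A(D)`:

* `abs_sum_re_zetaMul_mul_rpow_sub_main_le` —
  `|G(X) − (X^{1-β}/(1-β)) ∑_{d ≤ D} χ(d)/d| ≤ 2 D^{-β} ((q+1) A(D) + q/(1−β))`.

This is the evaluation "at `s = β`" of the classical asymptotic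
`∑_{n≤x} (1∗χ)(n)/n = L(1,χ)(log x + γ) + L'(1,χ) + O(q x^{-1/2} log x)` used by Tao–Teräväinen
(Proposition 3.5); at the zero the constant term disappears and no value of `L` or `L'` is needed.

## References

* T. Tao, J. Teräväinen, *The Hardy–Littlewood–Chowla conjecture in the presence of a Siegel
  zero*, J. London Math. Soc. 106 (2022), §3.3, proof of Proposition 3.5. [TaoTeravainen2021]
* H. L. Montgomery, R. C. Vaughan, *Multiplicative Number Theory I*, CUP 2007, §2.1
  (hyperbola method). [MontgomeryVaughan2007]
-/

noncomputable section

open Finset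
open Literature.NumberTheory.LFunctions.DirichletAbel

namespace Literature.NumberTheory.LFunctions.SiegelZero

variable {q : ℕ} [NeZero q] (χ : DirichletCharacter ℂ q)

/-! ### `f = 1 ∗ χ` and the hyperbola rearrangement -/

omit [NeZero q] in
/-- `Re (1 ∗ χ)(n) = ∑_{d ∣ n} Re χ(d)` (Mathlib's `zetaMul`). [folklore] -/
theorem re_zetaMul_apply (n : ℕ) :
    (χ.zetaMul n).re = ∑ d ∈ n.divisors, (χ (d : ZMod q)).re := by
  rw [DirichletCharacter.zetaMul, ArithmeticFunction.coe_zeta_mul_apply, Complex.re_sum]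
  refine Finset.sum_congr rfl fun d hd => ?_
  have hd0 : d ≠ 0 := (Nat.pos_of_mem_divisors hd).ne'
  simp [toArithmeticFunction, hd0]

omit [NeZero q] in
/-- **Dirichlet's hyperbola rearrangement for `∑ (1∗χ)(n) n^{-β}`**:
`∑_{n ≤ X} (1∗χ)(n) n^{-β} = ∑_{d ≤ X} χ(d) d^{-β} ∑_{e ≤ X/d} e^{-β}`.
[cite: MontgomeryVaughan2007, §2.1] -/
theorem sum_re_zetaMul_mul_rpow_eq (β : ℝ) (X : ℕ) :
    ∑ n ∈ Icc 1 X, (χ.zetaMul n).re * (n : ℝ) ^ (-β) =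
      ∑ d ∈ Icc 1 X, (χ (d : ZMod q)).re * (d : ℝ) ^ (-β) *
        ∑ e ∈ Icc 1 (X / d), (e : ℝ) ^ (-β) := by
  have h1 : ∀ n ∈ Icc 1 X, (χ.zetaMul n).re * (n : ℝ) ^ (-β) =
      ∑ p ∈ n.divisorsAntidiagonal,
        (χ (p.1 : ZMod q)).re * (p.1 : ℝ) ^ (-β) * (p.2 : ℝ) ^ (-β) := by
    intro n hn
    rw [re_zetaMul_apply, Finset.sum_mul,
      Nat.sum_divisorsAntidiagonal (fun d e => (χ (d : ZMod q)).re * (d : ℝ) ^ (-β) * (e : ℝ) ^ (-β))]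
    refine Finset.sum_congr rfl fun d hd => ?_
    have hdn : d ∣ n := Nat.dvd_of_mem_divisors hd
    have hcast : (n : ℝ) = d * ((n / d : ℕ) : ℝ) := by
      rw [← Nat.cast_mul, Nat.mul_div_cancel' hdn]
    rw [hcast, Real.mul_rpow (Nat.cast_nonneg d) (Nat.cast_nonneg _)]
    ring
  rw [Finset.sum_congr rfl h1,
    Literature.NumberTheory.Sieve.SquarefreeSums.sum_Icc_sum_divisorsAntidiagonal
      (fun d e => (χ (d : ZMod q)).re * (d : ℝ) ^ (-β) * (e : ℝ) ^ (-β)) X]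
  refine Finset.sum_congr rfl fun d _ => ?_
  rw [Finset.mul_sum]

/-! ### The tail `d > D`: Abel summation against a non-increasing weight -/

/-- **The tail of the hyperbola sum**: for a quadratic `χ ≠ χ₀`, `β ≥ 0` and any `X, N, M`,
`|∑_{N < d ≤ M} χ(d) d^{-β} A(⌊X/d⌋)| ≤ 2q (N+1)^{-β} A(⌊X/(N+1)⌋)`, `A(K) = ∑_{e ≤ K} e^{-β}`
(the weight `d ↦ d^{-β} A(⌊X/d⌋)` is non-negative and non-increasing).
[cite: MontgomeryVaughan2007, §1.3 Thm. 1.3 with §4.3 eq. (4.23)] -/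
theorem abs_sum_Ioc_re_mul_rpow_mul_sum_le (hχ : χ ≠ 1) (hq : χ ^ 2 = 1) {β : ℝ} (hβ0 : 0 ≤ β)
    (X N M : ℕ) :
    |∑ d ∈ Ioc N M, (χ (d : ZMod q)).re *
        ((d : ℝ) ^ (-β) * ∑ e ∈ Icc 1 (X / d), (e : ℝ) ^ (-β))| ≤
      2 * q * (((N + 1 : ℕ) : ℝ) ^ (-β) * ∑ e ∈ Icc 1 (X / (N + 1)), (e : ℝ) ^ (-β)) := by
  refine abs_sum_Ioc_re_mul_le χ hχ hq
    (a := fun d : ℕ => (d : ℝ) ^ (-β) * ∑ e ∈ Icc 1 (X / d), (e : ℝ) ^ (-β))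
    (fun n _ => mul_nonneg (Real.rpow_nonneg (Nat.cast_nonneg n) _) (sum_Icc_rpow_nonneg β _))
    (fun n hn => ?_) M
  have hn0 : 0 < n := lt_of_le_of_lt (Nat.zero_le N) hn
  have h1 : ((n + 1 : ℕ) : ℝ) ^ (-β) ≤ (n : ℝ) ^ (-β) :=
    Real.rpow_le_rpow_of_nonpos (by exact_mod_cast hn0) (by push_cast; linarith) (by linarith)
  have h2 : ∑ e ∈ Icc 1 (X / (n + 1)), (e : ℝ) ^ (-β) ≤ ∑ e ∈ Icc 1 (X / n), (e : ℝ) ^ (-β) :=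
    sum_Icc_rpow_mono β (Nat.div_le_div_left (Nat.le_succ n) hn0)
  exact mul_le_mul h1 h2 (sum_Icc_rpow_nonneg β _) (Real.rpow_nonneg (Nat.cast_nonneg n) _)

/-! ### The head `d ≤ D`: comparison of `A(⌊X/d⌋)` with `A(D)` -/

/-- **The head terms**: for `0 ≤ β < 1`, `1 ≤ d`, `1 ≤ D ≤ ⌊X/d⌋`, the quantity
`ψ_d = A(D) + ((X/d)^{1−β} − D^{1−β})/(1−β) − A(⌊X/d⌋)` satisfies `0 ≤ ψ_d ≤ 2 D^{−β}`
(`A(⌊X/d⌋) − A(D)` is a window sum of `e^{-β}`, compared with `(⌊X/d⌋^{1−β} − D^{1−β})/(1−β)`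
up to `D^{−β}`, and `0 ≤ (X/d)^{1−β} − ⌊X/d⌋^{1−β} ≤ (1−β)⌊X/d⌋^{−β} ≤ (1−β) D^{−β}`). [folklore] -/
theorem head_term_bounds {β : ℝ} (hβ0 : 0 ≤ β) (hβ1 : β < 1) {X D d : ℕ} (hd : 1 ≤ d)
    (hD : 1 ≤ D) (hDd : D ≤ X / d) :
    0 ≤ ∑ e ∈ Icc 1 D, (e : ℝ) ^ (-β) + (((X : ℝ) / d) ^ (1 - β) - (D : ℝ) ^ (1 - β)) / (1 - β) -
        ∑ e ∈ Icc 1 (X / d), (e : ℝ) ^ (-β) ∧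
      ∑ e ∈ Icc 1 D, (e : ℝ) ^ (-β) + (((X : ℝ) / d) ^ (1 - β) - (D : ℝ) ^ (1 - β)) / (1 - β) -
        ∑ e ∈ Icc 1 (X / d), (e : ℝ) ^ (-β) ≤ 2 * (D : ℝ) ^ (-β) := by
  have hκ : 0 < 1 - β := by linarith
  have hI : ∀ K : ℕ, Finset.Icc 1 K = Finset.Ioc 0 K := fun K => by
    ext n; simp only [Finset.mem_Icc, Finset.mem_Ioc]; omega
  have hsplit : ∑ e ∈ Icc 1 (X / d), (e : ℝ) ^ (-β) =
      ∑ e ∈ Icc 1 D, (e : ℝ) ^ (-β) + ∑ e ∈ Ioc D (X / d), (e : ℝ) ^ (-β) := by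
    rw [hI, hI, Finset.sum_Ioc_consecutive _ (Nat.zero_le D) hDd]
  obtain ⟨hW1, hW2⟩ := sum_Ioc_rpow_bounds hβ0 hβ1 hD hDd
  -- the real number `X/d` has floor `⌊X/d⌋ = X / d`
  have hd0 : (0 : ℝ) < d := by exact_mod_cast hd
  have ht : (1 : ℝ) ≤ (X : ℝ) / d := by
    rw [le_div_iff₀ hd0, one_mul]
    have h1 : D * d ≤ X := (Nat.le_div_iff_mul_le hd).mp hDd
    have h2 : d ≤ D * d := Nat.le_mul_of_pos_left d hD
    exact_mod_cast h2.trans h1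
  obtain ⟨hF1, hF2⟩ := rpow_sub_floor_rpow_bounds hβ0 hβ1 ht
  rw [Nat.floor_div_eq_div] at hF1 hF2
  have hmono : ((X / d : ℕ) : ℝ) ^ (-β) ≤ (D : ℝ) ^ (-β) :=
    Real.rpow_le_rpow_of_nonpos (by exact_mod_cast hD) (by exact_mod_cast hDd) (by linarith)
  have hsplitκ : (((X : ℝ) / d) ^ (1 - β) - (D : ℝ) ^ (1 - β)) / (1 - β) =
      (((X : ℝ) / d) ^ (1 - β) - ((X / d : ℕ) : ℝ) ^ (1 - β)) / (1 - β) +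
        (((X / d : ℕ) : ℝ) ^ (1 - β) - (D : ℝ) ^ (1 - β)) / (1 - β) := by ring
  have hF1' : 0 ≤ (((X : ℝ) / d) ^ (1 - β) - ((X / d : ℕ) : ℝ) ^ (1 - β)) / (1 - β) :=
    div_nonneg hF1 hκ.le
  have hF2' : (((X : ℝ) / d) ^ (1 - β) - ((X / d : ℕ) : ℝ) ^ (1 - β)) / (1 - β) ≤
      ((X / d : ℕ) : ℝ) ^ (-β) := by
    rw [div_le_iff₀ hκ]; linarith
  rw [hsplit, hsplitκ]
  constructor
  · linarith
  · linarith

/-! ### The main estimate -/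

/-- **The hyperbola method at the zero** (the key estimate): for a quadratic `χ ≠ χ₀` mod `q`,
`0 < β < 1` with `L(β, χ) = 0`, and an integer `X ≥ 1` with `D = ⌊√X⌋`,
`|∑_{n ≤ X} (1∗χ)(n) n^{-β} − (X^{1−β}/(1−β)) ∑_{d ≤ D} χ(d)/d| ≤ 2 D^{−β} ((q+1) A(D) + q/(1−β))`,
`A(D) = ∑_{e ≤ D} e^{−β}`. The zero enters only through `|∑_{d ≤ D} χ(d) d^{−β}| ≤ 2q(D+1)^{−β}`.
[cite: TaoTeravainen2021, §3.3 proof of Proposition 3.5 (asymptotic for ∑ (1∗χ)(n)/n), adapted] -/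
theorem abs_sum_re_zetaMul_mul_rpow_sub_main_le (hχ : χ ≠ 1) (hq : χ ^ 2 = 1) {β : ℝ}
    (hβ0 : 0 < β) (hβ1 : β < 1) (h0 : χ.LFunction β = 0) {X : ℕ} (hX : 1 ≤ X) :
    |∑ n ∈ Icc 1 X, (χ.zetaMul n).re * (n : ℝ) ^ (-β) -
        (X : ℝ) ^ (1 - β) / (1 - β) * ∑ d ∈ Icc 1 (Nat.sqrt X), (χ (d : ZMod q)).re / d| ≤
      2 * ((Nat.sqrt X : ℕ) : ℝ) ^ (-β) *
        ((q + 1) * ∑ e ∈ Icc 1 (Nat.sqrt X), (e : ℝ) ^ (-β) + q / (1 - β)) := by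
  set D : ℕ := Nat.sqrt X with hDdef
  set A : ℕ → ℝ := fun K => ∑ e ∈ Icc 1 K, (e : ℝ) ^ (-β) with hAdef
  set χr : ℕ → ℝ := fun d => (χ (d : ZMod q)).re with hχrdef
  have hκ : 0 < 1 - β := by linarith
  have hD1 : 1 ≤ D := Nat.le_sqrt.mpr (by simpa using hX)
  have hDX : D ≤ X := Nat.sqrt_le_self X
  have hD0 : (0 : ℝ) < D := by exact_mod_cast hD1
  have hχr1 : ∀ d : ℕ, |χr d| ≤ 1 := fun d =>
    (Complex.abs_re_le_norm _).trans (χ.norm_le_one _)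
  have hA0 : ∀ K, 0 ≤ A K := fun K => sum_Icc_rpow_nonneg β K
  have hI : ∀ K : ℕ, Finset.Icc 1 K = Finset.Ioc 0 K := fun K => by
    ext n; simp only [Finset.mem_Icc, Finset.mem_Ioc]; omega
  -- Step 1: hyperbola identity and the split at `D`
  have hG : ∑ n ∈ Icc 1 X, (χ.zetaMul n).re * (n : ℝ) ^ (-β) =
      ∑ d ∈ Icc 1 D, χr d * (d : ℝ) ^ (-β) * A (X / d) +
        ∑ d ∈ Ioc D X, χr d * (d : ℝ) ^ (-β) * A (X / d) := by
    rw [sum_re_zetaMul_mul_rpow_eq χ β X, hI X, hI D,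
      Finset.sum_Ioc_consecutive _ (Nat.zero_le D) hDX]
  -- Step 2: the tail
  have htail : |∑ d ∈ Ioc D X, χr d * (d : ℝ) ^ (-β) * A (X / d)| ≤
      2 * q * ((D : ℝ) ^ (-β) * A D) := by
    have h := abs_sum_Ioc_re_mul_rpow_mul_sum_le χ hχ hq hβ0.le X D X
    have e : ∑ d ∈ Ioc D X, χr d * (d : ℝ) ^ (-β) * A (X / d) =
        ∑ d ∈ Ioc D X, χr d * ((d : ℝ) ^ (-β) * A (X / d)) :=
      Finset.sum_congr rfl fun d _ => by ring
    rw [e]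
    refine h.trans ?_
    have h1 : ((D + 1 : ℕ) : ℝ) ^ (-β) ≤ (D : ℝ) ^ (-β) :=
      Real.rpow_le_rpow_of_nonpos hD0 (by push_cast; linarith) (by linarith)
    have hXD : X / (D + 1) ≤ D := by
      have hlt : X < (D + 1) * (D + 1) := Nat.lt_succ_sqrt X
      exact Nat.le_of_lt_succ ((Nat.div_lt_iff_lt_mul (Nat.succ_pos D)).mpr hlt)
    have h2 : A (X / (D + 1)) ≤ A D := sum_Icc_rpow_mono β hXD
    have hq0 : (0 : ℝ) ≤ 2 * q := by positivity
    exact mul_le_mul_of_nonneg_left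
      (mul_le_mul h1 h2 (hA0 _) (Real.rpow_nonneg hD0.le _)) hq0
  -- Step 3: the head, decomposed
  have hhead : ∑ d ∈ Icc 1 D, χr d * (d : ℝ) ^ (-β) * A (X / d) =
      (A D - (D : ℝ) ^ (1 - β) / (1 - β)) * ∑ d ∈ Icc 1 D, χr d * (d : ℝ) ^ (-β) +
      (X : ℝ) ^ (1 - β) / (1 - β) * ∑ d ∈ Icc 1 D, χr d / d -
      ∑ d ∈ Icc 1 D, χr d * (d : ℝ) ^ (-β) *
        (A D + (((X : ℝ) / d) ^ (1 - β) - (D : ℝ) ^ (1 - β)) / (1 - β) - A (X / d)) := by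
    rw [Finset.mul_sum, Finset.mul_sum, ← Finset.sum_add_distrib, ← Finset.sum_sub_distrib]
    refine Finset.sum_congr rfl fun d hd => ?_
    have hd1 : (0 : ℝ) < d := by exact_mod_cast (Finset.mem_Icc.mp hd).1
    have hX0 : (0 : ℝ) ≤ X := Nat.cast_nonneg X
    have key : (d : ℝ) ^ (-β) * ((X : ℝ) / d) ^ (1 - β) = (X : ℝ) ^ (1 - β) / d := by
      rw [Real.div_rpow hX0 hd1.le]
      have hdd : (d : ℝ) ^ (-β) / (d : ℝ) ^ (1 - β) = 1 / d := by
        rw [← Real.rpow_sub hd1, show -β - (1 - β) = -1 by ring, Real.rpow_neg_one, one_div]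
      calc (d : ℝ) ^ (-β) * ((X : ℝ) ^ (1 - β) / (d : ℝ) ^ (1 - β))
          = (X : ℝ) ^ (1 - β) * ((d : ℝ) ^ (-β) / (d : ℝ) ^ (1 - β)) := by ring
        _ = (X : ℝ) ^ (1 - β) / d := by rw [hdd]; ring
    linear_combination (χr d / (1 - β)) * key
  -- Step 4: bounds for the three head pieces
  have hDχ : |∑ d ∈ Icc 1 D, χr d * (d : ℝ) ^ (-β)| ≤ 2 * q * (D : ℝ) ^ (-β) := by
    refine (abs_sum_Icc_re_mul_rpow_le_of_LFunction_eq_zero χ hχ hq hβ0 h0 D).trans ?_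
    have h1 : ((D + 1 : ℕ) : ℝ) ^ (-β) ≤ (D : ℝ) ^ (-β) :=
      Real.rpow_le_rpow_of_nonpos hD0 (by push_cast; linarith) (by linarith)
    exact mul_le_mul_of_nonneg_left h1 (by positivity)
  have hAD : |A D - (D : ℝ) ^ (1 - β) / (1 - β)| ≤ 1 / (1 - β) :=
    abs_sum_Icc_rpow_sub_le hβ0.le hβ1 hD1
  have hΨ : |∑ d ∈ Icc 1 D, χr d * (d : ℝ) ^ (-β) *
      (A D + (((X : ℝ) / d) ^ (1 - β) - (D : ℝ) ^ (1 - β)) / (1 - β) - A (X / d))| ≤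
      2 * (D : ℝ) ^ (-β) * A D := by
    refine (Finset.abs_sum_le_sum_abs _ _).trans ?_
    have hbound : ∀ d ∈ Icc 1 D, |χr d * (d : ℝ) ^ (-β) *
        (A D + (((X : ℝ) / d) ^ (1 - β) - (D : ℝ) ^ (1 - β)) / (1 - β) - A (X / d))| ≤
        (d : ℝ) ^ (-β) * (2 * (D : ℝ) ^ (-β)) := by
      intro d hd
      obtain ⟨hd1, hdD⟩ := Finset.mem_Icc.mp hd
      have hDd : D ≤ X / d := by
        rw [Nat.le_div_iff_mul_le hd1]
        exact (Nat.mul_le_mul_left D hdD).trans (Nat.sqrt_le X)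
      obtain ⟨hψ0, hψ2⟩ := head_term_bounds (X := X) hβ0.le hβ1 hd1 hD1 hDd
      have hdβ : 0 ≤ (d : ℝ) ^ (-β) := Real.rpow_nonneg (Nat.cast_nonneg d) _
      rw [abs_mul, abs_mul, abs_of_nonneg hdβ, abs_of_nonneg hψ0]
      calc |χr d| * (d : ℝ) ^ (-β) *
            (A D + (((X : ℝ) / d) ^ (1 - β) - (D : ℝ) ^ (1 - β)) / (1 - β) - A (X / d))
          ≤ 1 * (d : ℝ) ^ (-β) * (2 * (D : ℝ) ^ (-β)) := by
            gcongr
            exact hχr1 d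
        _ = (d : ℝ) ^ (-β) * (2 * (D : ℝ) ^ (-β)) := by ring
    refine (Finset.sum_le_sum hbound).trans (le_of_eq ?_)
    rw [← Finset.sum_mul]
    ring
  -- Step 5: assemble
  have hmainId : ∑ n ∈ Icc 1 X, (χ.zetaMul n).re * (n : ℝ) ^ (-β) -
      (X : ℝ) ^ (1 - β) / (1 - β) * ∑ d ∈ Icc 1 D, χr d / d =
      ∑ d ∈ Ioc D X, χr d * (d : ℝ) ^ (-β) * A (X / d) +
      (A D - (D : ℝ) ^ (1 - β) / (1 - β)) * ∑ d ∈ Icc 1 D, χr d * (d : ℝ) ^ (-β) -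
      ∑ d ∈ Icc 1 D, χr d * (d : ℝ) ^ (-β) *
        (A D + (((X : ℝ) / d) ^ (1 - β) - (D : ℝ) ^ (1 - β)) / (1 - β) - A (X / d)) := by
    rw [hG, hhead]; ring
  rw [hmainId]
  have hprod : |(A D - (D : ℝ) ^ (1 - β) / (1 - β)) * ∑ d ∈ Icc 1 D, χr d * (d : ℝ) ^ (-β)| ≤
      1 / (1 - β) * (2 * q * (D : ℝ) ^ (-β)) := by
    rw [abs_mul]
    exact mul_le_mul hAD hDχ (abs_nonneg _) (by positivity)
  calc |∑ d ∈ Ioc D X, χr d * (d : ℝ) ^ (-β) * A (X / d) +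
        (A D - (D : ℝ) ^ (1 - β) / (1 - β)) * ∑ d ∈ Icc 1 D, χr d * (d : ℝ) ^ (-β) -
        ∑ d ∈ Icc 1 D, χr d * (d : ℝ) ^ (-β) *
          (A D + (((X : ℝ) / d) ^ (1 - β) - (D : ℝ) ^ (1 - β)) / (1 - β) - A (X / d))|
      ≤ |∑ d ∈ Ioc D X, χr d * (d : ℝ) ^ (-β) * A (X / d)| +
        |(A D - (D : ℝ) ^ (1 - β) / (1 - β)) * ∑ d ∈ Icc 1 D, χr d * (d : ℝ) ^ (-β)| +
        |∑ d ∈ Icc 1 D, χr d * (d : ℝ) ^ (-β) *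
          (A D + (((X : ℝ) / d) ^ (1 - β) - (D : ℝ) ^ (1 - β)) / (1 - β) - A (X / d))| :=
        (abs_sub _ _).trans (by gcongr; exact abs_add_le _ _)
    _ ≤ 2 * q * ((D : ℝ) ^ (-β) * A D) + 1 / (1 - β) * (2 * q * (D : ℝ) ^ (-β)) +
        2 * (D : ℝ) ^ (-β) * A D := by gcongr
    _ = 2 * (D : ℝ) ^ (-β) * ((q + 1) * A D + q / (1 - β)) := by
        field_simp
        ring

end Literature.NumberTheory.LFunctions.SiegelZero

end
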